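import Summits.QuantumFields.YangMills.Theorems.SoloInformedU1HelicityGap
import HarnessLib
import HarnessLib.Audit.Tags

/-!
# QuantumFields / YangMills — the finite-volume (torus) form of the helicity-gap criterion for Wilson `U(1)₄` (solo seat `solo-QuantumFields-informed`, s18)

Companion to `SoloInformedU1HelicityGap.lean` (`K1` infrastructure for the abelian comparison theory; NOT a step towards
`YangMills`). `U1HelicityGapD4` quantifies over infinite-volume torus LIMIT STATES. What a weak-coupling analysis (an infrared
bound uniform in the volume) or a simulation actually delivers is a bound on the TORI themselves. This file states that
finite-volume form and proves that it suffices: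

* `U1Helicity.torusBoxVar β M N = ∑_{x,y ∈ B_N} ⟨sin θ_{(x;0,1)} sin θ_{(y;0,1)}⟩_{Λ_{M+1}, β}` and
  `U1Helicity.torusMeanPlaq β M = ⟨cos θ_{(0;0,1)}⟩_{Λ_{M+1}, β}` — torus Wilson-state expectations (`wilsonExpectation` of
  the torus versions `toTorusObservable` of the cylinder observables);
* `@[conjecture] U1HelicityGapTorusD4`: there is `β₁` such that for every `β > β₁` there are `δ > 0` and `N₀` such that for
  every `N ≥ N₀`, for all sufficiently large tori, `β · torusBoxVar β M N ≤ (torusMeanPlaq β M − δ) · #B_N` (a bound UNIFORM in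
  the volume, with `δ` independent of the limit state);
* `u1HelicityGapD4_of_torus : U1HelicityGapTorusD4 → U1HelicityGapD4` (limits of torus expectations of bounded continuous
  cylinder observables along the defining subsequence of a limit state, `le_of_tendsto_of_tendsto`), hence
  `abelianMasslessPhaseD4_of_u1HelicityGapTorusD4 : U1HelicityGapTorusD4 → AbelianMasslessPhaseD4`.
-/

noncomputable section

open MeasureTheory Filter Topology ProbabilityTheory Finset
open Literature.Probability.LatticeModels hiding configShift configShift_apply
open Literature.MathematicalPhysics.QuantumLattice
open Literature.MathematicalPhysics.QuantumFieldTheory hiding IsLocalObservable Site ZdEdge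
open Literature.MathematicalPhysics.QuantumFieldTheory.AreaLaw
open Literature.Barriers.QuantumFields

namespace Summit.QuantumFields.YangMills.Theorems

namespace U1Helicity

/-- The torus two-point box sum `∑_{x,y ∈ B_N} ⟨sin θ_{(x;0,1)} sin θ_{(y;0,1)}⟩_{Λ_{M+1}, β}` — the Wilson-state expectation on
the torus `(ℤ/(M+1)ℤ)⁴` of (the torus versions of) the products of plaquette sines; for `2N + 2 ≤ M + 1` it is the torus
variance `Var_{Λ_{M+1},β}(∑_{x ∈ B_N} sin θ_{(x;0,1)})`. -/
def torusBoxVar (β : ℝ) (M N : ℕ) : ℝ :=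
  ∑ x ∈ box 4 N, ∑ y ∈ box 4 N,
    wilsonExpectation (L := M + 1) u1Rep β
      (toTorusObservable (M + 1) (fun U : LGConfig 4 Circle => u1PlaqIm x 0 1 U * u1PlaqIm y 0 1 U))

/-- The torus mean plaquette `⟨cos θ_{(0;0,1)}⟩_{Λ_{M+1}, β}`. -/
def torusMeanPlaq (β : ℝ) (M : ℕ) : ℝ :=
  wilsonExpectation (L := M + 1) u1Rep β
    (toTorusObservable (M + 1) (fun U : LGConfig 4 Circle => ((ZdGaugeConfig.plaquette U 0 0 1 : Circle) : ℂ).re))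

variable {β : ℝ} {μ : Measure (LGConfig 4 Circle)}

/-- Expanding the square: `∫ (∑_{x ∈ B_N} s_x)² dμ = ∑_{x,y ∈ B_N} ∫ s_x s_y dμ` in any finite measure. -/
theorem integral_boxSum_sq (μ : Measure (LGConfig 4 Circle)) [IsFiniteMeasure μ] (N : ℕ) :
    ∫ U, (∑ x ∈ box 4 N, u1PlaqIm x 0 1 U) ^ 2 ∂μ =
      ∑ x ∈ box 4 N, ∑ y ∈ box 4 N, ∫ U, u1PlaqIm x 0 1 U * u1PlaqIm y 0 1 U ∂μ := by
  have hint : ∀ x y : Literature.Probability.LatticeModels.Site 4,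
      Integrable (fun U => u1PlaqIm x 0 1 U * u1PlaqIm y 0 1 U) μ := fun x y =>
    integrable_of_continuous ((continuous_u1PlaqIm _ _ _).mul (continuous_u1PlaqIm _ _ _))
      (C := 1) fun U => by
        rw [abs_mul]
        exact mul_le_one₀ (abs_u1PlaqIm_le _ _ _ _) (abs_nonneg _) (abs_u1PlaqIm_le _ _ _ _)
  simp only [sq, Finset.sum_mul_sum]
  rw [integral_finsetSum _ (fun x _ => integrable_finsetSum _ fun y _ => hint x y)]
  refine Finset.sum_congr rfl fun x _ => ?_
  rw [integral_finsetSum _ (fun y _ => hint x y)]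

/-- Along the defining subsequence of a limit state, the torus two-point box sums converge to `∫ (∑_{x ∈ B_N} s_x)² dμ`. -/
theorem tendsto_torusBoxVar {φ : ℕ → ℕ} (hlim : IsInfiniteVolumeLimitAlong (d := 4) u1Rep β φ μ) (N : ℕ) :
    Tendsto (fun k : ℕ => torusBoxVar β (φ k) N) atTop
      (𝓝 (∫ U, (∑ x ∈ box 4 N, u1PlaqIm x 0 1 U) ^ 2 ∂μ)) := by
  obtain ⟨hprob, hconv⟩ := hlim
  rw [integral_boxSum_sq μ N]
  refine tendsto_finsetSum _ fun x _ => tendsto_finsetSum _ fun y _ => ?_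
  exact hconv (fun U => u1PlaqIm x 0 1 U * u1PlaqIm y 0 1 U)
    (Plaq.bonds (x, (0 : Fin 4), (1 : Fin 4)) ∪ Plaq.bonds (y, (0 : Fin 4), (1 : Fin 4)))
    (by rw [IsCylinder, Finset.coe_union]
        exact dependsOn_mul (dependsOn_u1PlaqIm _ _ _) (dependsOn_u1PlaqIm _ _ _))
    ((continuous_u1PlaqIm _ _ _).mul (continuous_u1PlaqIm _ _ _))
    ⟨1, fun U => by
      rw [abs_mul]
      exact mul_le_one₀ (abs_u1PlaqIm_le _ _ _ U) (abs_nonneg _) (abs_u1PlaqIm_le _ _ _ U)⟩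

/-- Along the defining subsequence of a limit state, the torus mean plaquettes converge to `⟨cos θ_p⟩_μ`. -/
theorem tendsto_torusMeanPlaq {φ : ℕ → ℕ} (hlim : IsInfiniteVolumeLimitAlong (d := 4) u1Rep β φ μ) :
    Tendsto (fun k : ℕ => torusMeanPlaq β (φ k)) atTop
      (𝓝 (∫ U, ((ZdGaugeConfig.plaquette U 0 0 1 : Circle) : ℂ).re ∂μ)) := by
  obtain ⟨hprob, hconv⟩ := hlim
  have hfun : (fun U : LGConfig 4 Circle => ((ZdGaugeConfig.plaquette U 0 0 1 : Circle) : ℂ).re) =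
      u1LoopRe 0 0 1 1 1 := by
    funext U; exact (u1LoopRe_one_one 0 0 1 U).symm
  have h := hconv (u1LoopRe 0 0 1 1 1) (loopEdges 0 0 1 1 1) (dependsOn_u1LoopRe 0 0 1 1 1)
    (continuous_u1LoopRe 0 0 1 1 1) ⟨1, abs_u1LoopRe_le 0 0 1 1 1⟩
  simp only [torusMeanPlaq]
  rw [hfun]
  exact h

end U1Helicity

open U1Helicity

/-- **The torus (finite-volume) helicity-gap criterion for Wilson `U(1)₄` — OPEN.** There is `β₁` such that for every
`β > β₁` there are `δ > 0` and `N₀` such that for every `N ≥ N₀` there is `M₀` with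
`β · ∑_{x,y ∈ B_N} ⟨sin θ_{(x;0,1)} sin θ_{(y;0,1)}⟩_{Λ_{M+1},β} ≤ (⟨cos θ_p⟩_{Λ_{M+1},β} − δ) · #B_N` for all `M ≥ M₀`:
the electric susceptibility per plaquette of large cubes, measured in the torus Wilson states, stays a fixed amount below the
Gauss-law value, uniformly in the volume. This is the form in which a volume-uniform infrared bound (or a simulation) delivers
the helicity gap; it implies `U1HelicityGapD4` (`u1HelicityGapD4_of_torus`) with a state-independent `δ`. Like
`U1HelicityGapD4` it fails at strong coupling and is expected at weak coupling (free photon: ratio `→ 1/2`). -/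
@[conjecture] def U1HelicityGapTorusD4 : Prop :=
  ∃ β₁ : ℝ, ∀ β : ℝ, β₁ < β → ∃ δ : ℝ, 0 < δ ∧ ∃ N₀ : ℕ, ∀ N : ℕ, N₀ ≤ N → ∃ M₀ : ℕ, ∀ M : ℕ, M₀ ≤ M →
    β * torusBoxVar β M N ≤ (torusMeanPlaq β M - δ) * #(box 4 N)

/-- **Finite volume suffices.** `U1HelicityGapTorusD4 → U1HelicityGapD4`: for a limit state `μ` along tori `Λ_{φ(k)+1}`
(`φ` strictly increasing, so `φ k ≥ k` is eventually `≥ M₀`), both sides of the torus inequality converge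
(`tendsto_torusBoxVar`, `tendsto_torusMeanPlaq`) and the inequality passes to the limit (`le_of_tendsto_of_tendsto`). -/
theorem u1HelicityGapD4_of_torus (h : U1HelicityGapTorusD4) : U1HelicityGapD4 := by
  obtain ⟨β₁, hβ⟩ := h
  refine ⟨β₁, fun β hb μ hμ => ?_⟩
  obtain ⟨δ, hδ, N₀, hN⟩ := hβ β hb
  refine ⟨δ, hδ, N₀, fun N hNN => ?_⟩
  obtain ⟨M₀, hM⟩ := hN N hNN
  obtain ⟨φ, hφ, hlim⟩ := hμ
  have h1 := (tendsto_torusBoxVar hlim N).const_mul β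
  have h2 := ((tendsto_torusMeanPlaq hlim).sub_const δ).mul_const (#(box 4 N) : ℝ)
  refine le_of_tendsto_of_tendsto h1 h2 ?_
  filter_upwards [eventually_ge_atTop M₀] with k hk
  exact hM (φ k) (le_trans hk (hφ.id_le k))

/-- Hence the torus criterion also implies the open conjecture `AbelianMasslessPhaseD4`. -/
theorem abelianMasslessPhaseD4_of_u1HelicityGapTorusD4 (h : U1HelicityGapTorusD4) : AbelianMasslessPhaseD4 :=
  abelianMasslessPhaseD4_of_u1HelicityGapD4 (u1HelicityGapD4_of_torus h)

end Summit.QuantumFields.YangMills.Theorems
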